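import Summits.BirchSwinnertonDyer.BirchSwinnertonDyer.Theorems.InertBadSignedBranchesInertBadAtThreeOffIstarZeroOfLowerHalf
import Literature.NumberTheory.EllipticCurves.BSDShaProofs
import HarnessLib

/-!
# Route `InertBadSignedBranches` (rung K8), HELD residual `InertBadAtThreeOffIstarZero` (stmt-BirchSwinnertonDyer-19657):
# its CHEAPEST FALSIFIER in the kernel — the residual predicts an EVEN `ord₃ #Ш(W)_an` on the off-type
# corner at `3` (helper `--supports` 19657; cell bsd-cm, seat bsd-cm-k8i-c42 g0; nothing asserted)

The residual says `ord₃ #Ш(W)_an = ord₃ #Ш(W)` for every rank-one CM curve `W/ℚ` of signed type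
`(3, III)` or `(3, III*)` (p417833 §1). With `Ш(W)` finite in analytic rank one (GZK, named fact
`hGZK`) and Cassels' alternating pairing (named fact `exists_casselsTate_pairing`, tree corollary
`isSquare_shaOrder_of_casselsTate`: `#Ш` is a square), the right-hand side is EVEN. So the residual
PREDICTS: `ord₃ #Ш(W)_an` is even at every such pair (§1), and ONE pair with an odd `ord₃ #Ш(W)_an`
REFUTES it (§2, contrapositive) — the residual's cheapest falsifier, testable by a certified `#Ш_an`
alone (no descent, no Heegner index, no Manin datum). The seat's census beyond Cremona (kit
j249101, `y² = x³ + Ax`, `|A| ≤ 2·10⁴`, `v₃(A)` odd) is the test; in Cremona's range all 97 classes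
have `#Ш_an = 1` (memo N18 v1.2). HONEST LABEL: bookkeeping over two named facts; nothing booked; the
residual stays HELD. [cite: SilvermanAEC2009, Thm. X.4.14] [cite: Miller2011LMS, §1 and Def. 1.1]
-/

set_option autoImplicit false
set_option linter.dupNamespace false

noncomputable section

open scoped Classical

open WeierstrassCurve
open Literature.NumberTheory.EllipticCurves
open Literature.NumberTheory.EllipticCurves.Rank1Residual
open Literature.NumberTheory.EllipticCurves.Rank1Residual.Typed
open Literature.NumberTheory.DiophantineGeometry (KodairaSymbol)
open Summit.BirchSwinnertonDyer.Rank1Residual.X12.O10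
open Summit.BirchSwinnertonDyer.BirchSwinnertonDyer.Theses.InertBadSignedBranches

namespace Summit.BirchSwinnertonDyer.BirchSwinnertonDyer.Theorems.InertBadOffParity

/-- A non-zero perfect square has even `p`-adic valuation. [folklore] -/
theorem even_padicValNat_of_isSquare {p n : ℕ} [Fact p.Prime] (hn : n ≠ 0) (h : IsSquare n) :
    Even (padicValNat p n) := by
  obtain ⟨m, rfl⟩ := h
  have hm : m ≠ 0 := fun h0 ↦ hn (by rw [h0, mul_zero])
  rw [padicValNat.mul hm hm]
  exact ⟨_, rfl⟩

/-! ## §1 The residual predicts an even `ord₃ #Ш_an` on the off-type corner at `3` -/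

/-- **`InertBadAtThreeOffIstarZero` ⟹ `ord₃ #Ш(W)_an` is EVEN** at every globally minimal CM curve
`W` of analytic rank one with `3` inert, bad, not of type `(3, I₀*)` — given GZK (`Ш(W)` finite,
`hGZK`) and the Cassels–Tate pairing (`#Ш(W)` a square, `hCT`). Bookkeeping: the residual gives
`#Ш_an = q ∈ ℚ` with `ord₃ q = ord₃ #Ш(W)`, and a non-zero square has even valuation.
[cite: SilvermanAEC2009, Thm. X.4.14] [cite: Miller2011LMS, §1 and Def. 1.1] -/
theorem even_padicValRat_shaAn_of_inertBadAtThreeOffIstarZero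
    (hCT : WeierstrassCurve.exists_casselsTate_pairing (K := ℚ))
    (hGZK : rank_eq_analyticRank_of_analyticRank_le_one)
    (h : InertBadAtThreeOffIstarZero)
    (W : WeierstrassCurve ℚ) [W.IsElliptic] [W.IsGloballyMinimal] [Fact (Nat.Prime 3)]
    (hCM : W.HasCM) (hr : W.analyticRank = 1) (hin : CMInert W 3) (hbad : ¬ Good W 3)
    (hnT : ¬ HasSignedLocalType W 3 (.Istar 0)) {q : ℚ} (hq : shaAn W = (q : ℂ)) :
    Even (padicValRat 3 q) := by
  obtain ⟨q', hq', hv⟩ := h W hCM hr hin hbad hnT (fun hs ↦ hin.2 hs.2)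
  have hqq : q' = q := by exact_mod_cast hq'.symm.trans hq
  subst hqq
  have hfin : W.ShaFinite := (hGZK W (by rw [hr])).2
  have hsq : IsSquare W.shaOrder := WeierstrassCurve.isSquare_shaOrder_of_casselsTate hCT W hfin
  have h0 : W.shaOrder ≠ 0 := (WeierstrassCurve.shaOrder_pos W hfin).ne'
  obtain ⟨k, hk⟩ := even_padicValNat_of_isSquare (p := 3) h0 hsq
  rw [hv, hk]
  exact ⟨(k : ℤ), by push_cast; rfl⟩

/-! ## §2 The cheapest falsifier: one odd `ord₃ #Ш_an` on the corner refutes the residual -/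

/-- **Falsifier frame.** Given GZK and the Cassels–Tate pairing, ONE globally minimal CM curve `W`
of analytic rank one, `3` inert, bad, not of type `(3, I₀*)` (equivalently, by p417833 §1, a
`y² = x³ + Ax` with `v₃(A)` odd) with `#Ш(W)_an = q` and `ord₃ q` ODD refutes
`InertBadAtThreeOffIstarZero`. (No such pair is expected — it would contradict BSD; the census
kit j249101 tests `|A| ≤ 2·10⁴`.) [cite: SilvermanAEC2009, Thm. X.4.14] [cite: Miller2011LMS, §1 and Def. 1.1] -/
theorem not_inertBadAtThreeOffIstarZero_of_odd_witness
    (hCT : WeierstrassCurve.exists_casselsTate_pairing (K := ℚ))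
    (hGZK : rank_eq_analyticRank_of_analyticRank_le_one)
    (W : WeierstrassCurve ℚ) [W.IsElliptic] [W.IsGloballyMinimal] [Fact (Nat.Prime 3)]
    (hCM : W.HasCM) (hr : W.analyticRank = 1) (hin : CMInert W 3) (hbad : ¬ Good W 3)
    (hnT : ¬ HasSignedLocalType W 3 (.Istar 0)) {q : ℚ} (hq : shaAn W = (q : ℂ))
    (hodd : Odd (padicValRat 3 q)) : ¬ InertBadAtThreeOffIstarZero := fun h ↦
  Int.not_even_iff_odd.mpr hodd
    (even_padicValRat_shaAn_of_inertBadAtThreeOffIstarZero hCT hGZK h W hCM hr hin hbad hnT hq)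

/-- The same parity prediction read off the typed class target directly: `LowerHalfOnType 3 T`
(any `T`) + the published UPPER half is not needed — already `MissingPPartAt W 3` at a pair with
`Ш(W)` finite forces an even `ord₃ #Ш(W)_an`. Recorded for the census's PS@3 rows as well.
[cite: SilvermanAEC2009, Thm. X.4.14] [cite: Miller2011LMS, Def. 1.1] -/
theorem even_padicValRat_shaAn_of_missingPPartAt
    (hCT : WeierstrassCurve.exists_casselsTate_pairing (K := ℚ))
    (W : WeierstrassCurve ℚ) [W.IsElliptic] [Fact (Nat.Prime 3)] (hfin : W.ShaFinite)
    (hP : MissingPPartAt W 3) {q : ℚ} (hq : shaAn W = (q : ℂ)) : Even (padicValRat 3 q) := by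
  obtain ⟨q', hq', hv⟩ := hP
  have hqq : q' = q := by exact_mod_cast hq'.symm.trans hq
  subst hqq
  have hsq : IsSquare W.shaOrder := WeierstrassCurve.isSquare_shaOrder_of_casselsTate hCT W hfin
  have h0 : W.shaOrder ≠ 0 := (WeierstrassCurve.shaOrder_pos W hfin).ne'
  obtain ⟨k, hk⟩ := even_padicValNat_of_isSquare (p := 3) h0 hsq
  rw [hv, hk]
  exact ⟨(k : ℤ), by push_cast; rfl⟩

end Summit.BirchSwinnertonDyer.BirchSwinnertonDyer.Theorems.InertBadOffParity

end
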